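import Summits.QuantumFields.GaugeBoot.Certificates.SparseReducedWindow
import Summits.QuantumFields.GaugeBoot.Certificates.KZL2rpD4b14o5UpDA
import Summits.QuantumFields.GaugeBoot.Certificates.KZL2rpD4b14o5UpDB
import HarnessLib

/-!
# Kernel replay of the certsdp certificate `kzL2_D4_b14o5_max_rp_G2` — part G: factor-row assembly and objective (gb_lean_emit_win 0.10)

HONEST FRAMING (cell `pub-gaugeboot`): certified bounds on lattice expectations at stated coupling,
gauge group, dimension and torus size; NOT a mass gap, NOT a continuum limit, NOT a string tension;
NOT Yang–Mills-summit-bearing (barriers `FixedCouplingUltralocality`, `PerturbativeInvisibility`).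

Certificate sha256 `08f325fc3a68a6be4c266b2b0e83f4095e3d3933eaf9ec17d5d21f3460d21464` (problem `kzL2_D4_b14o5_max_rp_G2`, sha256 `051af1e8aee021a939760b3d2afc0f556962fd1b9d01dfcd43ef4165f4467fe8`): `GB` = all factor rows (data parts
`Certificates/KZL2rpD4b14o5UpD….lean` concatenated), the INTEGER objective row `cZ`, the certified bound `lowerQ`, and the kernel check
`gb_len` (factor rows fit the padded dimension 48). Windows: `Certificates/KZL2rpD4b14o5UpA….lean`; assembly + theorems: `Certificates/KZL2rpD4b14o5Up.lean`.
Data/plumbing only; nothing is claimed about lattice gauge theory in this file.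
-/

namespace Summit.QuantumFields.GaugeBoot.Certificates.KZL2rpD4b14o5Up

noncomputable section

open Summit.QuantumFields.GaugeBoot.Certificates.Sparse

/-- All factor rows (concatenation of the data parts' block lists). -/
def GB : List (List (List ℤ)) := GBa ++ GBb

/-- Objective as a sparse INTEGER row: (-1)·y_1. -/
def cZ : List (ℕ × ℤ) := [(1, Int.negSucc 0)]

/-- The certified lower bound on the objective (exact): `-1843070554053624701159421439147/2499076342734616247087923200000` (≈ -0.7375007007736). -/
def lowerQ : ℚ := -1843070554053624701159421439147/2499076342734616247087923200000

set_option maxHeartbeats 0 in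
/-- Kernel check: every factor row of every block has length `≤ 48`. -/
theorem gb_len : lenCheckAll KZL2rpD4b14o5Up.GB 48 70 = true := by
  decide +kernel

end

end Summit.QuantumFields.GaugeBoot.Certificates.KZL2rpD4b14o5Up
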